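import Summits.CriticalPhenomena.Ising3DConformalLimit.Theorems.HyperoctahedralRPHRP2Rigidity
import Summits.CriticalPhenomena.Ising3DConformalLimit.Theorems.HyperoctahedralRPTwoPointLimitIsotropicHolds
import Summits.CriticalPhenomena.Ising3DConformalLimit.Theorems.HyperoctahedralRPLimitRotationInvariant
import Summits.CriticalPhenomena.Ising3DConformalLimit.Theorems.RotationUpgradeFromTwoPoint.Negative.AutomaticOrders
import HarnessLib

/-!
# Route HyperoctahedralRP — HEADLINE corollaries of the landed cruxes (A) `HRP2Rigidity` and (B) `LimitRotationInvariant`: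
# `O(3)` invariance of every non-degenerate pointwise scaling limit of the critical `ℤ³` Ising correlators

THEOREM-ONLY file (no definitions, no named facts, glue only), written for the publication enclosure of the
conditional `O(3)`-invariance package (items stmt-CriticalPhenomena-1979 / 1980 / 8367 with supports 1983 / 1984 /
1985); it is a root module of that enclosure so that the statements a reader is shown are declarations of the tree.

* `limitRotationInvariant_unconditional` — the route decl `LimitRotationInvariant` (stmt-1980) with its antecedent
  `HRP2Rigidity` (stmt-1979) DISCHARGED by the landed `HRP2Rigidity_of`: for every renormalisation `ρ > 0` on `(0,1]`,
  every `Δ`, and every pointwise scaling limit `S` of `criticalCorr 3` which is normalised (`S = 0` off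
  `NonCoincident`), non-degenerate, translation invariant and scale covariant with dimension `Δ`, `S` is invariant
  under every linear isometry of `ℝ³` at every order (`IsRotationInvariant S`).
* `isRotationInvariant_of_limit` — the HYPOTHESIS-MINIMAL form: translation invariance and scale covariance are
  themselves consequences of (existence of the full `δ → 0⁺` limit) + normalisation + non-degeneracy (landed
  `RotationUpgradeFromTwoPointNegative.translation_redundant`, `….scale_redundant`), so the four hypotheses
  `ρ > 0`, `HasPointwiseScalingLimit (criticalCorr 3) ρ S`, `S = 0` off `NonCoincident`, `IsNondegenerateTwoPoint S`
  already give `IsRotationInvariant S`.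
* `euclidean_and_scaleCovariant_of_limit` — under the same four hypotheses: `IsEuclideanInvariant S` and
  `IsScaleCovariant Δ S` for some `Δ ∈ [1/2, 1]` (Kadanoff's translation / rotation / scaling postulates, recalled as
  postulates in H. Duminil-Copin, Proc. ICM 2022, §8.1, p. 25, are OUTPUTS once the pointwise limit exists and is
  non-degenerate).
* `twoPoint_eq_const_mul_norm_rpow` — the two-point function of such a limit is `S₂(a, b) = S₂(0, e₀) ‖a - b‖^{-2Δ}`
  (`a ≠ b`), `Δ ∈ [1/2, 1]`.

What is NOT claimed: existence of the limit (route crux (C) `ExistsScaleCovariantLimit`, open), inversion /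
Möbius covariance (crux (D), open), `U₄ ≢ 0` (crux (E), open).  References: H. Duminil-Copin, *100 years of the
(critical) Ising model on the hypercubic lattice*, Proc. ICM 2022, §8.1 (rotation invariance on `ℤ³` postulated);
J. Fröhlich, R. Israel, E. H. Lieb, B. Simon, Comm. Math. Phys. 62 (1978) §3 (reflection positivity in site planes).
-/

noncomputable section

namespace Summit.CriticalPhenomena.Ising3DConformalLimit.HyperoctahedralRPHeadline

open Literature.Probability.LatticeModels
open Summit.CriticalPhenomena.Ising3DConformalLimit.Cruxes.HRP2Rigidity.XRayMellin (HRP2Rigidity_of)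
open Summit.CriticalPhenomena.Ising3DConformalLimit.Cruxes.LimitRotationInvariant.QuarterTurnLiouville
  (limitRotationInvariant_proof)
open Summit.CriticalPhenomena.Ising3DConformalLimit.RotationUpgradeFromTwoPointNegative
  (translation_redundant scale_redundant two_point_law)
open Summit.CriticalPhenomena.Ising3DConformalLimit.HyperoctahedralRPTwoPoint (kernel_rotation_invariant)

/-- **All-orders `O(3)` invariance of the critical `ℤ³` Ising scaling limit, given existence and scale
covariance** — the route decl `LimitRotationInvariant` (item stmt-CriticalPhenomena-1980) with its antecedent
`HRP2Rigidity` (item stmt-CriticalPhenomena-1979, nine-mirror reflection-positivity rigidity) discharged by the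
landed theorem `HRP2Rigidity_of`: for every `ρ > 0` on `(0,1]`, `Δ : ℝ` and pointwise scaling limit `S` of
`criticalCorr 3` which is normalised, non-degenerate, translation invariant and scale covariant with dimension `Δ`,
`S n (R x₁, …, R xₙ) = S n (x₁, …, xₙ)` for every `n`, every linear isometry `R` of `ℝ³` and every configuration.
[cite: DuminilCopinICM2022, §8.1 p. 25] -/
theorem limitRotationInvariant_unconditional :
    ∀ (ρ : ℝ → ℝ) (Δ : ℝ) (S : CorrFamily 3), (∀ δ ∈ Set.Ioc (0:ℝ) 1, 0 < ρ δ) →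
      HasPointwiseScalingLimit (criticalCorr 3) ρ S → (∀ n z, z ∉ NonCoincident 3 n → S n z = 0) →
      IsNondegenerateTwoPoint S → IsTranslationInvariant S → IsScaleCovariant Δ S →
      IsRotationInvariant S :=
  limitRotationInvariant_proof HRP2Rigidity_of

/-- **Hypothesis-minimal form.**  For every renormalisation `ρ > 0` on `(0,1]` and every pointwise scaling limit
`S` of the critical `ℤ³` Ising correlators `criticalCorr 3` (full limit `δ → 0⁺`, locally uniformly on
non-coincident configurations, at every order) which is normalised (`S = 0` off `NonCoincident`) and has a
non-degenerate two-point function, `S` is invariant under every linear isometry of `ℝ³` at every order.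
Translation invariance (`translation_redundant`) and scale covariance with some `Δ ∈ [1/2, 1]` (`scale_redundant`)
are automatic for such limits, after which `limitRotationInvariant_unconditional` applies.
[cite: DuminilCopinICM2022, §8.1 p. 25] -/
theorem isRotationInvariant_of_limit {ρ : ℝ → ℝ} {S : CorrFamily 3} (hρ : ∀ δ ∈ Set.Ioc (0:ℝ) 1, 0 < ρ δ)
    (hlim : HasPointwiseScalingLimit (criticalCorr 3) ρ S) (hnorm : ∀ n z, z ∉ NonCoincident 3 n → S n z = 0)
    (hnd : IsNondegenerateTwoPoint S) : IsRotationInvariant S := by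
  obtain ⟨Δ, -, hsc⟩ := scale_redundant hρ hlim hnorm hnd
  exact limitRotationInvariant_unconditional ρ Δ S hρ hlim hnorm hnd (translation_redundant hlim hnorm) hsc

/-- **Euclidean invariance and scale covariance as outputs.**  Under the four hypotheses of
`isRotationInvariant_of_limit`, the limit is Euclidean invariant (translations and all of `O(3)`) and scale covariant
with some dimension `Δ ∈ [1/2, 1]` (the window is the tree's `scalingDimension_mem_Icc_holds`: infrared bound above,
Simon–Lieb / sharpness below). [cite: DuminilCopinICM2022, §8.1 p. 25] -/
theorem euclidean_and_scaleCovariant_of_limit {ρ : ℝ → ℝ} {S : CorrFamily 3}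
    (hρ : ∀ δ ∈ Set.Ioc (0:ℝ) 1, 0 < ρ δ) (hlim : HasPointwiseScalingLimit (criticalCorr 3) ρ S)
    (hnorm : ∀ n z, z ∉ NonCoincident 3 n → S n z = 0) (hnd : IsNondegenerateTwoPoint S) :
    IsEuclideanInvariant S ∧ ∃ Δ ∈ Set.Icc (1 / 2 : ℝ) 1, IsScaleCovariant Δ S := by
  obtain ⟨Δ, hΔ, hsc⟩ := scale_redundant hρ hlim hnorm hnd
  exact ⟨⟨translation_redundant hlim hnorm, isRotationInvariant_of_limit hρ hlim hnorm hnd⟩, Δ, hΔ, hsc⟩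

/-- **The two-point function is the conformal power kernel.**  For every `ρ > 0` on `(0,1]`, `Δ`, and pointwise
scaling limit `S` of `criticalCorr 3` which is non-degenerate, translation invariant and scale covariant with
dimension `Δ`: `S₂(a, b) = S₂(0, e₀) · ‖a - b‖^{-2Δ}` for all `a ≠ b` (`e₀ = EuclideanSpace.single 0 1`, the first
coordinate vector), by two-point isotropy (`kernel_rotation_invariant` = milestone stmt-1984: nine-mirror rigidity applied to
the kernel `x ↦ S₂(0, x)`) and the model-blind `two_point_law`. [cite: DuminilCopinICM2022, §8.1 p. 25] -/
theorem twoPoint_eq_const_mul_norm_rpow {ρ : ℝ → ℝ} {Δ : ℝ} {S : CorrFamily 3}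
    (hρ : ∀ δ ∈ Set.Ioc (0:ℝ) 1, 0 < ρ δ) (hlim : HasPointwiseScalingLimit (criticalCorr 3) ρ S)
    (hnd : IsNondegenerateTwoPoint S) (htr : IsTranslationInvariant S) (hsc : IsScaleCovariant Δ S)
    {a b : EuclideanSpace ℝ (Fin 3)} (hab : a ≠ b) :
    S 2 ![a, b] = ‖a - b‖ ^ (-(2 * Δ)) * S 2 ![0, EuclideanSpace.single 0 (1:ℝ)] :=
  two_point_law htr hsc (fun R x _ => kernel_rotation_invariant hρ hlim hnd htr hsc R x) hab

end Summit.CriticalPhenomena.Ising3DConformalLimit.HyperoctahedralRPHeadline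

end
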